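/-
Origin: expansion seat `planner-pub-hodgecm-pv10-g4-0`, handover #10 2026-08-18T12:36:55Z (`HOME/pub-hodgecm-pv10-g4/lean/Pv10g4/ShimuraSetTower.lean`, md5 e98ded5a, 352 lines);
landed by the gen-8 packager in gate run 29 as `HodgeCM/PerL34/ShimuraSetTower.lean` (import ^import Pv10g4\.ShimuraSetDecomposition[ \t]*$→import HodgeCM.PerL34.ShimuraSetDecomposition ×1; import ^import Pv10g4\.CongruenceLatticeTower[ \t]*$→import HodgeCM.PerL34.CongruenceLatticeTower ×1; stripped 6 #print/#check/#eval lines).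
-/
/-
Origin: HOME/pub-hodgecm-pv10-g4/lean/Pv10g4/ShimuraSetTower.lean (WIP module `Pv10g4.ShimuraSetTower`;
intended final place `HodgeCM/PerL34/ShimuraSetTower.lean` = module `HodgeCM.PerL34.ShimuraSetTower`)
(import rewrites on landing: `import Pv10g4.ShimuraSetDecomposition` ↦ `import HodgeCM.PerL34.ShimuraSetDecomposition`,
`import Pv10g4.CongruenceLatticeTower` ↦ `import HodgeCM.PerL34.CongruenceLatticeTower`).
-/
import Summits.HodgeConjecture.HodgeCM.PerL34.ShimuraSetDecomposition_2
import Summits.HodgeConjecture.HodgeCM.PerL34.CongruenceLatticeTower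

/-!
# `S(K_f) = S(K₁)/(K_f/K₁)` — the tower of Shimura sets (PerL v5 l. 75, KERNEL, set level)

PerL v5 §1.2, l. 75: "`P_{K_f}` is the quotient of `P_{K_1}` by the finite group `K_f/K_1`" (for a normal
finite-index `K_1 ⊂ K_f`).  Row #7 defined `S(K_f; C) = ShimuraSet L H C Kf = U(H)(L⁺)\U(H)(𝔸_{L₀})/(C × K_f)`;
this file proves the quoted sentence AT SET LEVEL:

* §1 (abstract, any group `G`, `Γ K₁ K₂ ≤ G`): the LEVEL MAP `levelMap : Γ\G/K₁ → Γ\G/K₂` for `K₁ ≤ K₂`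
  (surjective); the right-translation ACTION of the normaliser `N_G(K)` on `Γ\G/K`, `n • [a] = [a n⁻¹]`
  (`instance normalizerMulAction`), trivial on `K` itself; for `K₂ ≤ N_G(K₁)` the fibres of the level map are the
  `K₂`-orbits (`levelMap_eq_iff`) and **`levelQuotientEquiv : (Γ\G/K₁)/K₂ ≃ Γ\G/K₂`** (orbit space of
  `K₂ ∩ N_G(K₁) = K₂` acting through `K₂/K₁`);
* §2 (PerL): for levels `K₁ ≤ K_f ≤ U(H)(𝔸_{L₀,f})` with `K₁ ⊴ K_f`, the homomorphism
  `finToNormalizer : K_f →* N(C × K₁)`, `k ↦ (1, k)`, the surjection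
  **`shimuraLevelMap : ShimuraSet L H C K₁ → ShimuraSet L H C Kf`**, the action of `K_f` on `S(K₁; C)` it induces
  (trivial on `K₁`: `finToNormalizer_smul_eq_self_of_mem`), the fibre criterion `shimuraLevelMap_eq_iff`, and
  **`shimuraLevelEquiv : S(K₁; C)/K_f ≃ S(K_f; C)`**;
* §3 HEADLINE `HodgeCM.HermSpace3.exists_small_level_quotient`: for `G_U` and every compact open `K_f` there is a
  compact open `K₁ ≤ K_f ∩ K_H(3)`, normal of finite index in `K_f` (row #9: all pieces `Γ_j(K₁)` torsion-free, normal
  of finite index in `Γ_j(K_f)`), with `K_f/K₁` FINITE and `S(K_f; C) ≃ S(K₁; C)/K_f`.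

Kernel theorems over rows #7/#9 and Mathlib only (no cited facts); `#print axioms` = the standard trio.
-/

noncomputable section

open scoped Pointwise
open HodgeCM.Adelic HodgeCM.PerL34.AdelicUnitaryFactorisation

namespace HodgeCM.PerL34.Godement

/-! ## §1  Level change and the normaliser action on `Γ\G/K` (abstract) -/

section LevelChange

variable {G : Type*} [Group G] (Γ K₁ K₂ : Subgroup G)

/-- The LEVEL MAP `Γ\G/K₁ → Γ\G/K₂` for `K₁ ≤ K₂`. -/
def levelMap (h : K₁ ≤ K₂) :
    DoubleCoset.Quotient (Γ : Set G) (K₁ : Set G) → DoubleCoset.Quotient (Γ : Set G) (K₂ : Set G) :=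
  Quotient.lift (fun a : G => DoubleCoset.mk Γ K₂ a) (by
    intro a b hab
    obtain ⟨x, hx, k, hk, rfl⟩ := DoubleCoset.rel_iff.mp hab
    exact (DoubleCoset.eq _ _ _ _).mpr ⟨x, hx, k, h hk, rfl⟩)

/-- (Ported verbatim from the HodgeCMPerL package; no docstring in the source.) -/
@[simp] theorem levelMap_mk (h : K₁ ≤ K₂) (a : G) :
    levelMap Γ K₁ K₂ h (DoubleCoset.mk Γ K₁ a) = DoubleCoset.mk Γ K₂ a := rfl

/-- (Ported verbatim from the HodgeCMPerL package; no docstring in the source.) -/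
theorem levelMap_surjective (h : K₁ ≤ K₂) : Function.Surjective (levelMap Γ K₁ K₂ h) := by
  intro y
  induction y using Quotient.inductionOn with | h a => ?_
  exact ⟨DoubleCoset.mk Γ K₁ a, rfl⟩

variable (K : Subgroup G)

/-- **Right translation by the normaliser**: `N_G(K)` acts on `Γ\G/K` by `n • [a] = [a n⁻¹]`. -/
instance normalizerMulAction : MulAction (Subgroup.normalizer (K : Set G)) (DoubleCoset.Quotient (Γ : Set G) (K : Set G)) where
  smul n := Quotient.lift (fun a : G => DoubleCoset.mk Γ K (a * (n : G)⁻¹)) (by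
    intro a b hab
    obtain ⟨x, hx, k, hk, rfl⟩ := DoubleCoset.rel_iff.mp hab
    refine (DoubleCoset.eq _ _ _ _).mpr ⟨x, hx, (n : G) * k * (n : G)⁻¹,
      (Subgroup.mem_normalizer_iff.mp n.2 k).mp hk, ?_⟩
    simp only [mul_assoc, inv_mul_cancel_left])
  one_smul x := by
    induction x using Quotient.inductionOn with | h a => ?_
    change DoubleCoset.mk Γ K (a * ((1 : (Subgroup.normalizer (K : Set G))) : G)⁻¹) = DoubleCoset.mk Γ K a
    rw [Subgroup.coe_one, inv_one, mul_one]
  mul_smul m n x := by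
    induction x using Quotient.inductionOn with | h a => ?_
    change DoubleCoset.mk Γ K (a * ((m * n : (Subgroup.normalizer (K : Set G))) : G)⁻¹) =
      DoubleCoset.mk Γ K (a * (n : G)⁻¹ * (m : G)⁻¹)
    rw [Subgroup.coe_mul, mul_inv_rev, mul_assoc]

/-- (Ported verbatim from the HodgeCMPerL package; no docstring in the source.) -/
theorem normalizer_smul_mk (n : (Subgroup.normalizer (K : Set G))) (a : G) :
    n • DoubleCoset.mk Γ K a = DoubleCoset.mk Γ K (a * (n : G)⁻¹) := rfl

/-- `K` itself acts trivially on `Γ\G/K`. -/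
theorem normalizer_smul_eq_self_of_mem (n : (Subgroup.normalizer (K : Set G))) (hn : (n : G) ∈ K)
    (x : DoubleCoset.Quotient (Γ : Set G) (K : Set G)) : n • x = x := by
  induction x using Quotient.inductionOn with | h a => ?_
  change DoubleCoset.mk Γ K (a * (n : G)⁻¹) = DoubleCoset.mk Γ K a
  exact (DoubleCoset.eq _ _ _ _).mpr ⟨1, Γ.one_mem, n, hn, by simp only [one_mul, inv_mul_cancel_right]⟩

/-- The level map is constant on `K₂`-orbits. -/
theorem levelMap_smul (h : K₁ ≤ K₂) (n : (Subgroup.normalizer (K₁ : Set G))) (hn : (n : G) ∈ K₂)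
    (x : DoubleCoset.Quotient (Γ : Set G) (K₁ : Set G)) :
    levelMap Γ K₁ K₂ h (n • x) = levelMap Γ K₁ K₂ h x := by
  induction x using Quotient.inductionOn with | h a => ?_
  change DoubleCoset.mk Γ K₂ (a * (n : G)⁻¹) = DoubleCoset.mk Γ K₂ a
  exact (DoubleCoset.eq _ _ _ _).mpr ⟨1, Γ.one_mem, n, hn, by simp only [one_mul, inv_mul_cancel_right]⟩

/-- **The fibres of the level map `Γ\G/K₁ → Γ\G/K₂` are the `K₂`-orbits** (for `K₁ ≤ K₂ ≤ N_G(K₁)`, e.g. `K₁ ⊴ K₂`). -/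
theorem levelMap_eq_iff (h : K₁ ≤ K₂) (hN : K₂ ≤ (Subgroup.normalizer (K₁ : Set G)))
    (x y : DoubleCoset.Quotient (Γ : Set G) (K₁ : Set G)) :
    levelMap Γ K₁ K₂ h x = levelMap Γ K₁ K₂ h y ↔ ∃ n : (Subgroup.normalizer (K₁ : Set G)), (n : G) ∈ K₂ ∧ n • y = x := by
  constructor
  · induction x using Quotient.inductionOn with | h a => ?_
    induction y using Quotient.inductionOn with | h b => ?_
    intro hab
    change DoubleCoset.mk Γ K₂ a = DoubleCoset.mk Γ K₂ b at hab
    obtain ⟨γ, hγ, k, hk, rfl⟩ := (DoubleCoset.eq _ _ _ _).mp hab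
    refine ⟨⟨k, hN hk⟩, hk, ?_⟩
    change DoubleCoset.mk Γ K₁ (γ * a * k * k⁻¹) = DoubleCoset.mk Γ K₁ a
    exact (DoubleCoset.eq _ _ _ _).mpr ⟨γ⁻¹, Γ.inv_mem hγ, 1, K₁.one_mem, by
      simp only [mul_inv_cancel_right, mul_one, inv_mul_cancel_left]⟩
  · rintro ⟨n, hn, rfl⟩
    exact levelMap_smul Γ K₁ K₂ h n hn y

/-- `K₁ ⊴ K₂` (inside `K₂`, with `K₁ ≤ K₂`) iff `K₂` normalises `K₁` — the hypothesis shape used below. -/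
theorem le_normalizer_of_normal_subgroupOf (h : K₁ ≤ K₂) [hN : (K₁.subgroupOf K₂).Normal] :
    K₂ ≤ (Subgroup.normalizer (K₁ : Set G)) :=
  (Subgroup.normal_subgroupOf_iff_le_normalizer h).mp hN

/-- **`(Γ\G/K₁)/K₂ ≃ Γ\G/K₂`**: for `K₁ ≤ K₂ ≤ N_G(K₁)` the level map identifies `Γ\G/K₂` with the orbit space of
`Γ\G/K₁` under `K₂` (acting through the finite group `K₂/K₁` when `[K₂ : K₁] < ∞`, since `K₁` acts trivially). -/
def levelQuotientEquiv (h : K₁ ≤ K₂) (hN : K₂ ≤ (Subgroup.normalizer (K₁ : Set G))) :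
    MulAction.orbitRel.Quotient (K₂.subgroupOf (Subgroup.normalizer (K₁ : Set G))) (DoubleCoset.Quotient (Γ : Set G) (K₁ : Set G)) ≃
      DoubleCoset.Quotient (Γ : Set G) (K₂ : Set G) :=
  Equiv.ofBijective
    (Quotient.lift (levelMap Γ K₁ K₂ h) (by
      intro x y hxy
      obtain ⟨k, rfl⟩ := MulAction.orbitRel_apply.mp hxy
      exact levelMap_smul Γ K₁ K₂ h (k : (Subgroup.normalizer (K₁ : Set G))) k.2 y))
    ⟨by
      intro x y
      induction x using Quotient.inductionOn with | h x => ?_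
      induction y using Quotient.inductionOn with | h y => ?_
      intro hxy
      obtain ⟨n, hn, rfl⟩ := (levelMap_eq_iff Γ K₁ K₂ h hN x y).mp hxy
      exact Quotient.sound (MulAction.orbitRel_apply.mpr ⟨⟨n, hn⟩, rfl⟩),
     by
      intro z
      obtain ⟨x, rfl⟩ := levelMap_surjective Γ K₁ K₂ h z
      exact ⟨Quotient.mk _ x, rfl⟩⟩

/-- (Ported verbatim from the HodgeCMPerL package; no docstring in the source.) -/
theorem levelQuotientEquiv_mk (h : K₁ ≤ K₂) (hN : K₂ ≤ (Subgroup.normalizer (K₁ : Set G)))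
    (x : DoubleCoset.Quotient (Γ : Set G) (K₁ : Set G)) :
    levelQuotientEquiv Γ K₁ K₂ h hN (Quotient.mk _ x) = levelMap Γ K₁ K₂ h x := rfl

end LevelChange

/-! ## §2  The Shimura sets `S(K_f; C)` of row #7 -/

section PerL

variable (L : CMField) {m : ℕ} (H : Matrix (Fin m) (Fin m) L) (C : Subgroup (Uinf L H))

/-- (Ported verbatim from the HodgeCMPerL package; no docstring in the source.) -/
theorem adelicLevel_mono {K₁ Kf : Subgroup (Ufin L H)} (h : K₁ ≤ Kf) :
    adelicLevel L H C K₁ ≤ adelicLevel L H C Kf := by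
  intro g hg
  rw [mem_adelicLevel_iff] at hg ⊢
  exact ⟨hg.1, h hg.2⟩

/-- `(1, b) ∈ U(H)(𝔸_{L₀})` for `b ∈ U(H)(𝔸_{L₀,f})`. -/
def finEmb : Ufin L H →* adelicUnitaryGroup L H :=
  (splitEquiv L H).symm.toMulEquiv.toMonoidHom.comp (MonoidHom.inr (Uinf L H) (Ufin L H))

/-- (Ported verbatim from the HodgeCMPerL package; no docstring in the source.) -/
@[simp] theorem splitEquiv_finEmb (b : Ufin L H) : splitEquiv L H (finEmb L H b) = (1, b) := by
  change splitEquiv L H ((splitEquiv L H).symm (1, b)) = (1, b)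
  exact (splitEquiv L H).apply_symm_apply _

/-- (Ported verbatim from the HodgeCMPerL package; no docstring in the source.) -/
theorem finEmb_mem_adelicLevel_iff (Kf : Subgroup (Ufin L H)) (b : Ufin L H) :
    finEmb L H b ∈ adelicLevel L H C Kf ↔ b ∈ Kf := by
  rw [mem_adelicLevel_iff, splitEquiv_finEmb]
  exact ⟨fun h => h.2, fun h => ⟨C.one_mem, h⟩⟩

variable {C} in
/-- **`K_f` normalises the level group `C × K₁` when `K₁ ⊴ K_f`**: the homomorphism `K_f →* N(C × K₁)`,
`k ↦ (1, k)`. -/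
def finToNormalizer {K₁ Kf : Subgroup (Ufin L H)} (h : K₁ ≤ Kf) [hN : (K₁.subgroupOf Kf).Normal] :
    Kf →* (Subgroup.normalizer (adelicLevel L H C K₁ : Set (adelicUnitaryGroup L H))) :=
  ((finEmb L H).comp Kf.subtype).codRestrict _ (by
    intro k
    rw [Subgroup.mem_normalizer_iff]
    intro g
    rw [mem_adelicLevel_iff, mem_adelicLevel_iff]
    simp only [MonoidHom.coe_comp, Subgroup.coe_subtype, Function.comp_apply, map_mul, map_inv,
      splitEquiv_finEmb, Prod.fst_mul, Prod.snd_mul, Prod.fst_inv, Prod.snd_inv, one_mul, inv_one,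
      mul_one]
    refine and_congr Iff.rfl ⟨fun hg => (Subgroup.normal_subgroupOf_iff h).mp hN _ _ hg k.2, fun hg => ?_⟩
    have h' := (Subgroup.normal_subgroupOf_iff h).mp hN _ _ hg (Kf.inv_mem k.2)
    simpa only [inv_inv, mul_assoc, inv_mul_cancel_left, inv_mul_cancel, mul_one] using h')

/-- (Ported verbatim from the HodgeCMPerL package; no docstring in the source.) -/
theorem coe_finToNormalizer {K₁ Kf : Subgroup (Ufin L H)} (h : K₁ ≤ Kf) [(K₁.subgroupOf Kf).Normal] (k : Kf) :
    ((finToNormalizer L H (C := C) h k : (Subgroup.normalizer (adelicLevel L H C K₁ : Set (adelicUnitaryGroup L H)))) : adelicUnitaryGroup L H) =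
      finEmb L H k := rfl

/-- **The level map of Shimura sets** `S(K₁; C) → S(K_f; C)` for `K₁ ≤ K_f`. -/
def shimuraLevelMap {K₁ Kf : Subgroup (Ufin L H)} (h : K₁ ≤ Kf) : ShimuraSet L H C K₁ → ShimuraSet L H C Kf :=
  levelMap (adelicUnitaryRat L H) _ _ (adelicLevel_mono L H C h)

/-- (Ported verbatim from the HodgeCMPerL package; no docstring in the source.) -/
@[simp] theorem shimuraLevelMap_mk {K₁ Kf : Subgroup (Ufin L H)} (h : K₁ ≤ Kf) (g : adelicUnitaryGroup L H) :
    shimuraLevelMap L H C h (DoubleCoset.mk _ _ g) = DoubleCoset.mk _ _ g := rfl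

/-- (Ported verbatim from the HodgeCMPerL package; no docstring in the source.) -/
theorem shimuraLevelMap_surjective {K₁ Kf : Subgroup (Ufin L H)} (h : K₁ ≤ Kf) :
    Function.Surjective (shimuraLevelMap L H C h) :=
  levelMap_surjective _ _ _ _

/-- The `K_f`-action on `S(K₁; C)`: `k • [g] = [g · (1, k)⁻¹]`. -/
theorem finToNormalizer_smul_mk {K₁ Kf : Subgroup (Ufin L H)} (h : K₁ ≤ Kf) [(K₁.subgroupOf Kf).Normal] (k : Kf)
    (g : adelicUnitaryGroup L H) :
    finToNormalizer L H (C := C) h k • (DoubleCoset.mk _ _ g : ShimuraSet L H C K₁) =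
      DoubleCoset.mk _ _ (g * (finEmb L H k)⁻¹) := rfl

/-- `K₁` acts trivially: the `K_f`-action on `S(K₁; C)` factors through `K_f/K₁`. -/
theorem finToNormalizer_smul_eq_self_of_mem {K₁ Kf : Subgroup (Ufin L H)} (h : K₁ ≤ Kf)
    [(K₁.subgroupOf Kf).Normal] (k : Kf) (hk : (k : Ufin L H) ∈ K₁) (x : ShimuraSet L H C K₁) :
    finToNormalizer L H (C := C) h k • x = x :=
  normalizer_smul_eq_self_of_mem _ _ _ ((finEmb_mem_adelicLevel_iff L H C K₁ k).mpr hk) x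

/-- (Ported verbatim from the HodgeCMPerL package; no docstring in the source.) -/
theorem shimuraLevelMap_smul {K₁ Kf : Subgroup (Ufin L H)} (h : K₁ ≤ Kf) [(K₁.subgroupOf Kf).Normal] (k : Kf)
    (x : ShimuraSet L H C K₁) :
    shimuraLevelMap L H C h (finToNormalizer L H (C := C) h k • x) = shimuraLevelMap L H C h x :=
  levelMap_smul _ _ _ _ _ ((finEmb_mem_adelicLevel_iff L H C Kf k).mpr k.2) x

/-- **The fibres of `S(K₁; C) → S(K_f; C)` are the `K_f`-orbits.** -/
theorem shimuraLevelMap_eq_iff {K₁ Kf : Subgroup (Ufin L H)} (h : K₁ ≤ Kf) [(K₁.subgroupOf Kf).Normal]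
    (x y : ShimuraSet L H C K₁) :
    shimuraLevelMap L H C h x = shimuraLevelMap L H C h y ↔ ∃ k : Kf, finToNormalizer L H (C := C) h k • y = x := by
  constructor
  · intro hxy
    have hN : adelicLevel L H C Kf ≤ (Subgroup.normalizer (adelicLevel L H C K₁ : Set (adelicUnitaryGroup L H))) := by
      intro n hn
      rw [mem_adelicLevel_iff] at hn
      -- `n = (c, k) = (1, k) · (c, 1)` with `(c, 1) ∈ C × K₁ ≤ N(C × K₁)` and `(1, k) ∈ N(C × K₁)`.
      have h1 : n = finEmb L H (splitEquiv L H n).2 * (splitEquiv L H).symm ((splitEquiv L H n).1, 1) := by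
        apply (splitEquiv L H).injective
        rw [map_mul, splitEquiv_finEmb]
        rw [(splitEquiv L H).apply_symm_apply, Prod.mk_mul_mk, one_mul, mul_one]
      rw [h1]
      refine Subgroup.mul_mem _ (finToNormalizer L H (C := C) h ⟨_, hn.2⟩).2 (Subgroup.le_normalizer ?_)
      rw [mem_adelicLevel_iff]
      rw [(splitEquiv L H).apply_symm_apply]
      exact ⟨hn.1, K₁.one_mem⟩
    obtain ⟨n, hn, rfl⟩ := (levelMap_eq_iff _ _ _ (adelicLevel_mono L H C h) hN x y).mp hxy
    have hn' := (mem_adelicLevel_iff L H C Kf _).mp hn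
    refine ⟨⟨(splitEquiv L H (n : adelicUnitaryGroup L H)).2, hn'.2⟩, ?_⟩
    -- `n = (1,k) · (c,1)` in the normaliser, and `(c,1)` acts trivially.
    let c : (Subgroup.normalizer (adelicLevel L H C K₁ : Set (adelicUnitaryGroup L H))) :=
      ⟨(splitEquiv L H).symm ((splitEquiv L H (n : adelicUnitaryGroup L H)).1, 1), Subgroup.le_normalizer (by
        rw [mem_adelicLevel_iff]
        rw [(splitEquiv L H).apply_symm_apply]
        exact ⟨hn'.1, K₁.one_mem⟩)⟩
    have hc : (c : adelicUnitaryGroup L H) ∈ adelicLevel L H C K₁ := by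
      rw [mem_adelicLevel_iff]
      change ((splitEquiv L H) ((splitEquiv L H).symm _)).1 ∈ C ∧ ((splitEquiv L H) ((splitEquiv L H).symm _)).2 ∈ K₁
      rw [(splitEquiv L H).apply_symm_apply]
      exact ⟨hn'.1, K₁.one_mem⟩
    have hnc : n = finToNormalizer L H (C := C) h ⟨(splitEquiv L H (n : adelicUnitaryGroup L H)).2, hn'.2⟩ * c := by
      apply Subtype.ext
      apply (splitEquiv L H).injective
      rw [Subgroup.coe_mul, map_mul, coe_finToNormalizer, splitEquiv_finEmb]
      change splitEquiv L H n = (1, (splitEquiv L H n).2) * splitEquiv L H ((splitEquiv L H).symm _)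
      rw [(splitEquiv L H).apply_symm_apply, Prod.mk_mul_mk, one_mul, mul_one]
    conv_rhs => rw [hnc]
    rw [mul_smul, normalizer_smul_eq_self_of_mem _ _ c hc]
  · rintro ⟨k, rfl⟩
    exact shimuraLevelMap_smul L H C h k y

/-- The level map descended to the `K_f`-orbit space of `S(K₁; C)`. -/
def shimuraOrbitMap {K₁ Kf : Subgroup (Ufin L H)} (h : K₁ ≤ Kf) [(K₁.subgroupOf Kf).Normal] :
    MulAction.orbitRel.Quotient (finToNormalizer L H (C := C) h).range (ShimuraSet L H C K₁) → ShimuraSet L H C Kf :=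
  Quotient.lift (shimuraLevelMap L H C h) (by
    intro x y hxy
    obtain ⟨⟨r, hr⟩, rfl⟩ := MulAction.orbitRel_apply.mp hxy
    obtain ⟨k, rfl⟩ := MonoidHom.mem_range.mp hr
    simpa only [Subgroup.mk_smul] using shimuraLevelMap_smul L H C h k y)

/-- (Ported verbatim from the HodgeCMPerL package; no docstring in the source.) -/
theorem shimuraOrbitMap_mk {K₁ Kf : Subgroup (Ufin L H)} (h : K₁ ≤ Kf) [(K₁.subgroupOf Kf).Normal]
    (x : ShimuraSet L H C K₁) :
    shimuraOrbitMap L H C h (Quotient.mk (MulAction.orbitRel _ _) x) = shimuraLevelMap L H C h x := rfl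

/-- (Ported verbatim from the HodgeCMPerL package; no docstring in the source.) -/
theorem shimuraOrbitMap_surjective {K₁ Kf : Subgroup (Ufin L H)} (h : K₁ ≤ Kf) [(K₁.subgroupOf Kf).Normal] :
    Function.Surjective (shimuraOrbitMap L H C h) := by
  intro z
  obtain ⟨x, rfl⟩ := shimuraLevelMap_surjective L H C h z
  exact ⟨Quotient.mk (MulAction.orbitRel _ _) x, shimuraOrbitMap_mk L H C h x⟩

/-- (Ported verbatim from the HodgeCMPerL package; no docstring in the source.) -/
theorem shimuraOrbitMap_injective {K₁ Kf : Subgroup (Ufin L H)} (h : K₁ ≤ Kf) [(K₁.subgroupOf Kf).Normal] :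
    Function.Injective (shimuraOrbitMap L H C h) := by
  intro x y
  induction x using Quotient.inductionOn with | h x => ?_
  induction y using Quotient.inductionOn with | h y => ?_
  intro hxy
  change shimuraLevelMap L H C h x = shimuraLevelMap L H C h y at hxy
  obtain ⟨k, rfl⟩ := (shimuraLevelMap_eq_iff L H C h x y).mp hxy
  refine Quotient.sound (MulAction.orbitRel_apply.mpr (MulAction.mem_orbit_iff.mpr ?_))
  exact ⟨⟨finToNormalizer L H (C := C) h k, MonoidHom.mem_range.mpr ⟨k, rfl⟩⟩, Subgroup.mk_smul _ _ _⟩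

/-- **PerL v5 l. 75 (KERNEL, set level): `S(K_f; C) ≃ S(K₁; C)/K_f`** — for `K₁ ≤ K_f` with `K₁ ⊴ K_f`, the level
map identifies `S(K_f; C)` with the orbit space of `S(K₁; C)` under `K_f` (acting by `k • [g] = [g (1,k)⁻¹]`,
through `K_f/K₁`). -/
def shimuraLevelEquiv {K₁ Kf : Subgroup (Ufin L H)} (h : K₁ ≤ Kf) [(K₁.subgroupOf Kf).Normal] :
    MulAction.orbitRel.Quotient (finToNormalizer L H (C := C) h).range (ShimuraSet L H C K₁) ≃
      ShimuraSet L H C Kf :=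
  Equiv.ofBijective (shimuraOrbitMap L H C h) ⟨shimuraOrbitMap_injective L H C h, shimuraOrbitMap_surjective L H C h⟩

/-- (Ported verbatim from the HodgeCMPerL package; no docstring in the source.) -/
theorem shimuraLevelEquiv_mk {K₁ Kf : Subgroup (Ufin L H)} (h : K₁ ≤ Kf) [(K₁.subgroupOf Kf).Normal]
    (x : ShimuraSet L H C K₁) :
    shimuraLevelEquiv L H C h (Quotient.mk (MulAction.orbitRel _ _) x) = shimuraLevelMap L H C h x := rfl

end PerL

end HodgeCM.PerL34.Godement

/-! ## §3  Headline for `G_U` -/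

namespace HodgeCM.HermSpace3

open HodgeCM.PerL34.Godement

variable (L : CMField) {ι₁ : L →+* ℂ} (V : HermSpace3 L ι₁)

/-- **PerL v5 ll. 74–75 for `G_U`, set + group level (KERNEL).**  For every compact open `K_f ≤ G_U(𝔸_{L₀,f})` and
every `C ≤ G_U(ℝ)` (e.g. `K_∞`) there is a compact open `K₁ ≤ K_f ∩ K_H(3)`, NORMAL of FINITE index in `K_f`
(so `K_f/K₁` is a finite group), such that every piece lattice `Γ_j(K₁) = Γ(g K₁ g⁻¹)` is TORSION-FREE (row #8/#9)
and **`S(K_f; C) ≃ S(K₁; C)/K_f`**, `K_f` acting through `K_f/K₁` — "`P_{K_f}` is the quotient of `P_{K_1}` by the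
finite group `K_f/K_1`". -/
theorem exists_small_level_quotient (Kf : Subgroup (Ufin L V.Hm)) (hKo : IsOpen (Kf : Set (Ufin L V.Hm)))
    (hKc : IsCompact (Kf : Set (Ufin L V.Hm))) (C : Subgroup (Uinf L V.Hm)) :
    ∃ (K₁ : Subgroup (Ufin L V.Hm)) (h : K₁ ≤ Kf) (_ : (K₁.subgroupOf Kf).Normal),
      K₁ ≤ levelUfin L V.Hm 3 ∧ IsOpen (K₁ : Set (Ufin L V.Hm)) ∧ IsCompact (K₁ : Set (Ufin L V.Hm)) ∧
      Finite (Kf ⧸ K₁.subgroupOf Kf) ∧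
      (∀ g : Ufin L V.Hm, ∀ γ ∈ congruenceLattice L V.Hm (MulAut.conj g • K₁), IsOfFinOrder γ → γ = 1) ∧
      (∀ k : Kf, (k : Ufin L V.Hm) ∈ K₁ → ∀ x : ShimuraSet L V.Hm C K₁, finToNormalizer L V.Hm (C := C) h k • x = x) ∧
      Nonempty (MulAction.orbitRel.Quotient (finToNormalizer L V.Hm (C := C) h).range (ShimuraSet L V.Hm C K₁) ≃
        ShimuraSet L V.Hm C Kf) := by
  obtain ⟨K₁, hK₁, hK₁lev, hK₁o, hK₁c, hN, hF, hpieces⟩ :=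
    HodgeCM.PerL34.Godement.exists_torsionFree_normal_tower L V.Hm Kf hKo hKc
  refine ⟨K₁, hK₁, hN, hK₁lev, hK₁o, hK₁c, ?_, fun g => (hpieces g).2.2.2.2,
    fun k hk x => finToNormalizer_smul_eq_self_of_mem L V.Hm C hK₁ k hk x, ⟨shimuraLevelEquiv L V.Hm C hK₁⟩⟩
  exact (Subgroup.finiteIndex_iff_finite_quotient).mp hF

end HodgeCM.HermSpace3

end

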